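import Summits.BirchSwinnertonDyer.BirchSwinnertonDyer.Theorems.ClassRecordThreeEulerHalvesAtThreeCartanTransportResiduePinning
import Summits.BirchSwinnertonDyer.BirchSwinnertonDyer.Theorems.ClassRecordThreeEulerHalvesAtThreeCartanCoverReduction
import HarnessLib

/-!
# Cartan transport, brick R — the reduction datum of the cover order EXISTS (`Nonempty (CoverReduction X q)` for `q ∈ C`)

Helper file for the crux `EulerHalvesAtThree` of route `ClassRecordThree` (node served: residue crux `EulerHalvesAtThreeResidualUpperBound`,
line `cartan`, item NUM := `CartanOnePlaceDegreeLawAtThree`, skeleton `Lines/lattice`). The LEAD's statement layer for `Lines/lattice` v2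
(memo `NUM-LINES-AND-D1-DESIGN-g26.md` §7) has ONE print-fact input about the cover order
`O₀' := X.O + n_q • X.O₀` (`CartanCover.coverOrder`, `n_q = ∏_{p ∈ C∖q} p`):

  (A)  `q ∈ C → Nonempty (CartanCover.CoverReduction X q)`

— a surjective ring map `red : O₀' → M₂(𝔽_q)` with kernel `q O₀'`, `det ∘ red = nrd (mod q)`, and a matrix `η` without rational eigenvalue
with `X.O = red⁻¹(𝔽_q[η])` [Voight 23.2.3 ∕ Def. 23.4.1]. THIS FILE PROVES (A) (`nonempty_coverReduction`) from the landed bricks H1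
(`Residue.exists_isMatrixResidueMap_of_mem`: residue models `ψ_p : X.O₀ → M₂(𝔽_p)` at every `p ∈ C`, `Residue.trace_det`) and H2b
(`ResiduePinning.exists_eta`, `mem_O_iff_residues`: `X.O = {x ∈ X.O₀ : ψ_p x ∈ 𝔽_p[η_p] ∀ p ∈ C}`), restricted from the hull to `O₀'`:
* §1 `n_q ≡ 0 (mod p)` for `p ∈ C∖q` and `n_q ≢ 0 (mod q)`;
* §2 `O₀' = {x ∈ X.O₀ : ψ_p x ∈ 𝔽_p[η_p] for all p ∈ C∖q}` (`residues_of_mem_coverOrder`, `mem_coverOrder_of_residues` — the correction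
  `x ↦ x + n_q z` with `ψ_q z = -n_q⁻¹ ψ_q x` lands in `X.O`; no Chinese remainder theorem is needed);
* §3 on `O₀'`: `ψ_q` is onto (`n_q • x₀`), has kernel `q O₀'` (`q⁻¹ (mod p)` rescaling of the residue conditions), `det ψ_q = nrd`, and
  `X.O = ψ_q⁻¹(𝔽_q[η_q]) ∩ O₀'`;
* §4 `nonempty_coverReduction`.
No definition is introduced (the `RingHom` is assembled inside the proof); nothing is proved about NUM, (F2b♮) or any summit statement.
[cite: Voight2021, Lemma 23.2.3, Def. 23.4.1, Thm. 28.5.3] [cite: KohenPacetti2016, §2 (arXiv:1403.7801v3 pp. 7–8)]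
-/

set_option linter.dupNamespace false
set_option autoImplicit false

open scoped MatrixGroups

namespace Summit.BirchSwinnertonDyer.BirchSwinnertonDyer.Theorems.CartanTransport.Cover

open Literature.NumberTheory.Automorphic
open Summit.BirchSwinnertonDyer.BirchSwinnertonDyer.Theorems.CartanDegree
open Summit.BirchSwinnertonDyer.BirchSwinnertonDyer.Theorems.CartanTransport
open Summit.BirchSwinnertonDyer.BirchSwinnertonDyer.Theorems.CartanCover

variable {D M : ℕ} {C : Finset ℕ}

/-! ## §1 The index `n_q = ∏_{p ∈ C∖q} p` modulo the primes of `C` -/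

/-- `n_q ≡ 0 (mod p)` for `p ∈ C`, `p ≠ q`. [folklore] -/
theorem natCast_coverIndex_eq_zero {p q : ℕ} (hp : p ∈ C) (hpq : p ≠ q) : ((coverIndex C q : ℕ) : ZMod p) = 0 := by
  rw [ZMod.natCast_eq_zero_iff, coverIndex]
  exact Finset.dvd_prod_of_mem (fun p => p) (Finset.mem_erase.mpr ⟨hpq, hp⟩)

/-- `n_q ≢ 0 (mod q)` for `q ∈ C` (the Cartan places are distinct primes). [folklore] -/
theorem natCast_coverIndex_ne_zero (X : CartanLevelCurveData D M C) {q : ℕ} (hq : q ∈ C) :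
    ((coverIndex C q : ℕ) : ZMod q) ≠ 0 := by
  rw [Ne, ZMod.natCast_eq_zero_iff, coverIndex, Prime.dvd_finsetProd_iff (Nat.prime_iff.mp (X.coprime q hq).1)]
  rintro ⟨p, hp, hdvd⟩
  obtain ⟨hpq, hpC⟩ := Finset.mem_erase.mp hp
  exact hpq ((Nat.prime_dvd_prime_iff_eq (X.coprime q hq).1 (X.coprime p hpC).1).mp hdvd).symm

/-! ## §2 The cover order by residue conditions away from `q` -/

section Residues

variable (X : CartanLevelCurveData D M C) (ψ : (p : ℕ) → X.B → Matrix (Fin 2) (Fin 2) (ZMod p))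
  (hψ : ∀ (p : ℕ) (hp : p ∈ C), haveI : Fact p.Prime := ⟨(X.coprime p hp).1⟩; IsMatrixResidueMap X.O₀ p (ψ p))
  (η : (p : ℕ) → Matrix (Fin 2) (Fin 2) (ZMod p))
  (hpin : ∀ x : X.B, x ∈ X.O ↔ x ∈ X.O₀ ∧ ∀ p ∈ C, ∃ c : ZMod p × ZMod p,
    ψ p x = c.1 • (1 : Matrix (Fin 2) (Fin 2) (ZMod p)) + c.2 • η p)

include hψ hpin

/-- An element of `O₀' = X.O + n_q X.O₀` satisfies the residue conditions of `X.O` at every `p ∈ C∖q`. [folklore] -/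
theorem residues_of_mem_coverOrder {q : ℕ} {x : X.B} (hx : x ∈ coverOrder X q) :
    ∀ p ∈ C, p ≠ q → ∃ c : ZMod p × ZMod p, ψ p x = c.1 • (1 : Matrix (Fin 2) (Fin 2) (ZMod p)) + c.2 • η p := by
  intro p hp hpq
  haveI : Fact p.Prime := ⟨(X.coprime p hp).1⟩
  obtain ⟨a, ha, y, hy, rfl⟩ := (mem_coverOrder_iff X q).mp hx
  obtain ⟨c, hc⟩ := ((hpin a).mp ha).2 p hp
  refine ⟨c, ?_⟩
  rw [(hψ p hp).map_add a (X.le ha) _ (X.O₀.smul_mem _ hy), (hψ p hp).map_zsmul hy, hc, ← Int.cast_smul_eq_zsmul (ZMod p),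
    Int.cast_natCast, natCast_coverIndex_eq_zero hp hpq, zero_smul, add_zero]

/-- Conversely, an element of the hull with the residue conditions of `X.O` at every `p ∈ C∖q` lies in `O₀'`: correct it at `q` by `n_q z` with
`ψ_q z = -n_q⁻¹ ψ_q x` to land in `X.O`. [folklore] -/
theorem mem_coverOrder_of_residues {q : ℕ} (hq : q ∈ C) {x : X.B} (hx : x ∈ X.O₀)
    (h : ∀ p ∈ C, p ≠ q → ∃ c : ZMod p × ZMod p, ψ p x = c.1 • (1 : Matrix (Fin 2) (Fin 2) (ZMod p)) + c.2 • η p) :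
    x ∈ coverOrder X q := by
  haveI : Fact q.Prime := ⟨(X.coprime q hq).1⟩
  obtain ⟨z, hz, hψz⟩ := (hψ q hq).surj (-((((coverIndex C q : ℕ) : ZMod q)⁻¹) • ψ q x))
  have ha : x + ((coverIndex C q : ℕ) : ℤ) • z ∈ X.O := by
    refine (hpin _).mpr ⟨X.O₀.add_mem hx (X.O₀.smul_mem _ hz), fun p hp => ?_⟩
    haveI : Fact p.Prime := ⟨(X.coprime p hp).1⟩
    rw [(hψ p hp).map_add x hx _ (X.O₀.smul_mem _ hz), (hψ p hp).map_zsmul hz, ← Int.cast_smul_eq_zsmul (ZMod p), Int.cast_natCast]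
    by_cases hpq : p = q
    · subst hpq
      refine ⟨0, ?_⟩
      rw [hψz, smul_neg, smul_smul, mul_inv_cancel₀ (natCast_coverIndex_ne_zero X hp), one_smul, add_neg_cancel, Prod.fst_zero,
        Prod.snd_zero, zero_smul, zero_smul, add_zero]
    · obtain ⟨c, hc⟩ := h p hp hpq
      exact ⟨c, by rw [natCast_coverIndex_eq_zero hp hpq, zero_smul, add_zero, hc]⟩
  refine (mem_coverOrder_iff X q).mpr ⟨_, ha, -z, X.O₀.neg_mem hz, ?_⟩
  rw [smul_neg, add_neg_cancel_right]

/-! ## §3 The model `ψ_q` restricted to the cover order -/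

omit hpin in
/-- `ψ_q` is onto already on `n_q X.O₀ ⊆ O₀'`. [folklore] -/
theorem exists_mem_coverOrder_eq {q : ℕ} (hq : q ∈ C) (m : Matrix (Fin 2) (Fin 2) (ZMod q)) : ∃ x ∈ coverOrder X q, ψ q x = m := by
  haveI : Fact q.Prime := ⟨(X.coprime q hq).1⟩
  obtain ⟨x₀, hx₀, hψx₀⟩ := (hψ q hq).surj ((((coverIndex C q : ℕ) : ZMod q)⁻¹) • m)
  refine ⟨_, smul_mem_coverOrder X q hx₀, ?_⟩
  rw [(hψ q hq).map_zsmul hx₀, ← Int.cast_smul_eq_zsmul (ZMod q), Int.cast_natCast, hψx₀, smul_smul,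
    mul_inv_cancel₀ (natCast_coverIndex_ne_zero X hq), one_smul]

/-- The kernel of `ψ_q` on `O₀'` is `q O₀'` (`y = x/q` keeps the residue conditions away from `q`, `q` being a unit there). [folklore] -/
theorem eq_zero_iff {q : ℕ} (hq : q ∈ C) {x : X.B} (hx : x ∈ coverOrder X q) :
    ψ q x = 0 ↔ ∃ y ∈ coverOrder X q, x = (q : ℤ) • y := by
  haveI : Fact q.Prime := ⟨(X.coprime q hq).1⟩
  have hx₀ : x ∈ X.O₀ := coverOrder_le X q hx
  constructor
  · intro h0
    obtain ⟨y, hy, rfl⟩ := ((hψ q hq).ker x hx₀).mp h0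
    refine ⟨y, mem_coverOrder_of_residues X ψ hψ η hpin hq hy fun p hp hpq => ?_, rfl⟩
    haveI : Fact p.Prime := ⟨(X.coprime p hp).1⟩
    obtain ⟨c, hc⟩ := residues_of_mem_coverOrder X ψ hψ η hpin hx p hp hpq
    have hqp : ((q : ℕ) : ZMod p) ≠ 0 := by
      rw [Ne, ZMod.natCast_eq_zero_iff]
      exact fun hdvd => hpq ((Nat.prime_dvd_prime_iff_eq (X.coprime p hp).1 (X.coprime q hq).1).mp hdvd)
    rw [(hψ p hp).map_zsmul hy, ← Int.cast_smul_eq_zsmul (ZMod p), Int.cast_natCast] at hc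
    refine ⟨((((q : ℕ) : ZMod p)⁻¹) * c.1, (((q : ℕ) : ZMod p)⁻¹) * c.2), ?_⟩
    rw [← one_smul (ZMod p) (ψ p y), ← inv_mul_cancel₀ hqp, mul_smul, hc, smul_add, smul_smul, smul_smul]
  · rintro ⟨y, hy, rfl⟩
    rw [(hψ q hq).map_zsmul (coverOrder_le X q hy), ← Int.cast_smul_eq_zsmul (ZMod q), Int.cast_natCast, ZMod.natCast_self, zero_smul]

/-- `X.O` inside `O₀'` is cut out by the single residue condition at `q`. [folklore] -/
theorem mem_O_iff {q : ℕ} (hq : q ∈ C) {x : X.B} (hx : x ∈ coverOrder X q) :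
    x ∈ X.O ↔ ∃ a b : ZMod q, ψ q x = a • (1 : Matrix (Fin 2) (Fin 2) (ZMod q)) + b • η q := by
  constructor
  · intro h
    obtain ⟨c, hc⟩ := ((hpin x).mp h).2 q hq
    exact ⟨c.1, c.2, hc⟩
  · rintro ⟨a, b, hab⟩
    refine (hpin x).mpr ⟨coverOrder_le X q hx, fun p hp => ?_⟩
    by_cases hpq : p = q
    · subst hpq
      exact ⟨(a, b), hab⟩
    · exact residues_of_mem_coverOrder X ψ hψ η hpin hx p hp hpq

end Residues

/-! ## §4 The reduction datum exists -/

/-- PROVED — **stub (A) of the statement layer of `Lines/lattice` v2: for `q ∈ C` the cover order `O₀'` has a reduction datum modulo `q`.**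
`red := ψ_q|O₀'` for a residue model `ψ_q` of the hull (brick H1), `η := η_q` the generator of the residue field pinning `X.O` at `q`
(brick H2b); onto by `n_q X.O₀ ⊆ O₀'`, kernel `q O₀'` and pinning by §§2–3, `det ∘ red = nrd` by `Residue.trace_det`.
[cite: Voight2021, Lemma 23.2.3, Def. 23.4.1] [cite: KohenPacetti2016, §2] -/
theorem nonempty_coverReduction (X : CartanLevelCurveData D M C) {q : ℕ} (hq : q ∈ C) : Nonempty (CoverReduction X q) := by
  classical
  haveI : Fact q.Prime := ⟨(X.coprime q hq).1⟩
  -- residue models of the hull at every `p ∈ C` (H1)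
  have hψex : ∀ p : ℕ, ∃ ψ : X.B → Matrix (Fin 2) (Fin 2) (ZMod p), ∀ hp : p ∈ C,
      haveI : Fact p.Prime := ⟨(X.coprime p hp).1⟩; IsMatrixResidueMap X.O₀ p ψ := by
    intro p
    by_cases hp : p ∈ C
    · haveI : Fact p.Prime := ⟨(X.coprime p hp).1⟩
      obtain ⟨ψ, hψ⟩ := Residue.exists_isMatrixResidueMap_of_mem X hp
      exact ⟨ψ, fun _ => hψ⟩
    · exact ⟨fun _ => 0, fun h => (hp h).elim⟩
  choose ψ hψ using hψex
  -- the residue fields pinning `X.O` (H2b)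
  have hηex : ∀ p : ℕ, ∃ η : Matrix (Fin 2) (Fin 2) (ZMod p), ∀ hp : p ∈ C, ¬ HasRatEigenvalue η ∧
      ∀ y ∈ X.O₀, ((∃ a ∈ X.O, ∃ z ∈ X.O₀, y - a = (p : ℤ) • z) ↔
        ∃ c : ZMod p × ZMod p, ψ p y = c.1 • (1 : Matrix (Fin 2) (Fin 2) (ZMod p)) + c.2 • η) := by
    intro p
    by_cases hp : p ∈ C
    · haveI : Fact p.Prime := ⟨(X.coprime p hp).1⟩
      obtain ⟨η, hη, hT⟩ := ResiduePinning.exists_eta X hp (hψ p hp)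
      exact ⟨η, fun _ => ⟨hη, fun y hy => ResiduePinning.mem_level_iff_exists_lin X (hψ p hp) hT hy⟩⟩
    · exact ⟨0, fun h => (hp h).elim⟩
  choose η hη using hηex
  have hpin : ∀ x : X.B, x ∈ X.O ↔ x ∈ X.O₀ ∧ ∀ p ∈ C, ∃ c : ZMod p × ZMod p,
      ψ p x = c.1 • (1 : Matrix (Fin 2) (Fin 2) (ZMod p)) + c.2 • η p :=
    ResiduePinning.mem_O_iff_residues X ψ η fun p hp y hy => (hη p hp).2 y hy
  have hle : ∀ x : coverSubring X q, (x : X.B) ∈ X.O₀ := fun x => coverOrder_le X q x.2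
  refine ⟨{
    red :=
      { toFun := fun x => ψ q x
        map_one' := (hψ q hq).map_one
        map_mul' := fun x y => (hψ q hq).map_mul _ (hle x) _ (hle y)
        map_zero' := (hψ q hq).map_zero
        map_add' := fun x y => (hψ q hq).map_add _ (hle x) _ (hle y) }
    red_surjective := fun m => ?_
    red_eq_zero_iff := fun x => ?_
    det_red := fun x => ?_
    η := η q
    η_irred := (hη q hq).1
    mem_O_iff := fun x => mem_O_iff X ψ hψ η hpin hq x.2 }⟩
  · obtain ⟨x, hx, hxm⟩ := exists_mem_coverOrder_eq X ψ hψ hq m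
    exact ⟨⟨x, hx⟩, hxm⟩
  · exact eq_zero_iff X ψ hψ η hpin hq x.2
  · obtain ⟨t, n, -, hn, -, hdet⟩ := Residue.trace_det (hψ q hq) X.isEichlerOrder.isOrder (hle x)
    exact ⟨n, hn, hdet⟩

end Summit.BirchSwinnertonDyer.BirchSwinnertonDyer.Theorems.CartanTransport.Cover
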